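import Mathlib.Data.ZMod.QuotientGroup
import Mathlib.Algebra.Group.Subgroup.Finite
import Mathlib.Tactic.LinearCombination
import Mathlib.Tactic.IntervalCases
import HarnessLib

/-!
# The coordinate-Lagrangian lemma over `ℤ/p^k` (`p` odd) — support statement S1 of the O5
# depth law R1♯ (cell `b2b-bsdres`, lane CLASS-CLOSURE; ask A-O5-G15-2 of the O5 planner seat
# o5-r2 GEN 15, `HOME/b2b-bsdres-o5-r2/gen15/R1SHARP-DERIVATION.md` §2 and
# `gen15/lean/CoordinateLagrangianLemma.lean`; served by the instrument seat cc-eng-5 GEN 43)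

HONEST FRAMING (cell `b2b-bsdres`, run/shared/lean/b2b/bsd-rank1-residual/, verbatim in every file):
the goal of the cell is to DELETE the COMBINATION-SHAPED residual classes of the Birch–Swinnerton-Dyer
formula for ALL analytic-rank `≤ 1` elliptic curves over `ℚ` — "full BSD formula for every rank `≤ 1`
curve in class `C`" assembled STRICTLY from published theorems — so that the rank-`≤ 1` remainder
becomes exactly the CONSTRUCTION-SHAPED classes, which are TYPED (missing-input `Prop`s), NOT
attempted. This is not "finishing BSD". This file is PURE ALGEBRA over the finite rings `ZMod (p ^ k)`:
five small definitions (the planner's vocabulary, verbatim from the ask) and fully proved theorems;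
no named fact, no `@[conjecture]` node, no `sorry`; net named-fact debt `0`. Its ARITHMETIC use in the
depth law R1♯ — `A = loc_q Sel^{q-rel}_{3^k} ⊂ H¹(ℚ_q, C[3^k]) = F_q ⊕ F'_q` at a Kolyvagin prime
`q ≡ 2 (mod 3)` — is NOT asserted here (that is the planner's EVIDENCE / THEOREM-CANDIDATE material,
`gen15/lean/DepthLawThree.lean`); nothing is booked; no mark of `RESIDUAL-MAP.md` moves; O5 stays OPEN.

## Statement (S1, `R1SHARP-DERIVATION.md` §2)

Let `p` be an ODD prime, `R = ℤ/p^k`, `V = R e ⊕ R f` with the (hyperbolic, symmetric) pairing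
`B((x,y),(x',y')) = x y' + x' y`. Every totally isotropic subgroup `A ⊂ V` of order `p^k` (a
"Lagrangian" of the hyperbolic plane over `ℤ/p^k`) is COORDINATE: `A = p^δ R ⊕ p^(k-δ) R` for a
(unique) `δ ∈ {0, …, k}`. This is the finite-level lift of "an isotropic line in a hyperbolic plane over
`𝔽_p` is one of the two coordinate lines" (the field case lives in
`O5/LagrangianDatumLinearAlgebra.lean`). It is FALSE for `p = 2` already at `k = 2`
(`⟨(1,2)⟩ ⊂ (ℤ/4)²` is isotropic of order `4` and not coordinate — `not_coordinateLagrangian_two_two`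
below), so the oddness hypothesis is load-bearing.

## Proof (as formalised; a variant of the planner's 6-line argument that avoids the structure theory of
## subgroups of a cyclic group)

Let `δ` be the largest `j ≤ k` with `p^j ∣ x.1` for every `x ∈ A` (if every `x.1 = 0` take `δ = k`).
Pick `x₀ ∈ A` with `x₀.1 = p^δ c`, `p ∤ c`; then `c ∈ R^×`. Isotropy of `x₀` with itself gives
`2 p^δ c x₀.2 = 0`, and `2, c ∈ R^×` give `p^δ x₀.2 = 0`. For `y ∈ A`, `y.1 = p^δ w`, so
`B(x₀, y) = p^δ c y.2 + w (p^δ x₀.2) = p^δ c y.2 = 0`, whence `p^δ y.2 = 0`, i.e. `p^(k-δ) ∣ y.2`.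
So `A ≤ C_δ := p^δ R × p^(k-δ) R`, and `#C_δ = p^(k-δ) · p^δ = p^k = #A` forces `A = C_δ`.

## Contents
* vocabulary (verbatim from the ask): `hypPairing`, `IsIsotropicSubgroup`, `IsCoordinate`,
  `CoordinateLagrangian`, `CoordinateLagrangianOdd`; plus `coordSubgroup` (the subgroup `C_δ`).
* `coordinateLagrangian_of_odd : p.Prime → p ≠ 2 → 1 ≤ k → CoordinateLagrangian p k` and
  `coordinateLagrangianOdd_holds : CoordinateLagrangianOdd` (S1 as asked).
* `isIsotropic_and_card_eq_iff_exists_eq_coordSubgroup`: the packaged characterisation — the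
  Lagrangians are EXACTLY the `k + 1` subgroups `C_δ`, `δ ≤ k` (`isIsotropic_coordSubgroup`,
  `card_coordSubgroup` give the converse direction).
* `IsCoordinate.unique`: the exponent `δ ≤ k` is unique.
* `not_coordinateLagrangian_two_two`: the lemma fails for `p = 2`, `k = 2`.
-/

namespace Summit.BirchSwinnertonDyer.Rank1Residual.O5

/-- The hyperbolic symmetric pairing on `R × R`, `R = ZMod n`: `B((x,y),(x',y')) = x y' + x' y`.
(o5-r2 GEN 15 vocabulary, verbatim.) -/
def hypPairing (n : ℕ) (a b : ZMod n × ZMod n) : ZMod n := a.1 * b.2 + b.1 * a.2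

/-- `A ⊆ R × R` is totally isotropic for the hyperbolic pairing. (o5-r2 GEN 15 vocabulary, verbatim.) -/
def IsIsotropicSubgroup (n : ℕ) (A : AddSubgroup (ZMod n × ZMod n)) : Prop :=
  ∀ a ∈ A, ∀ b ∈ A, hypPairing n a b = 0

/-- The coordinate subgroup `p^δ R × p^(k-δ) R` of `R × R`, `R = ZMod (p^k)`, described by
divisibility of the two coordinates. (o5-r2 GEN 15 vocabulary, verbatim.) -/
def IsCoordinate (p k δ : ℕ) (A : AddSubgroup (ZMod (p ^ k) × ZMod (p ^ k))) : Prop :=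
  ∀ x : ZMod (p ^ k) × ZMod (p ^ k),
    x ∈ A ↔ ((p ^ δ : ℕ) : ZMod (p ^ k)) ∣ x.1 ∧ ((p ^ (k - δ) : ℕ) : ZMod (p ^ k)) ∣ x.2

/-- S1, the coordinate-Lagrangian lemma at level `p^k`: every totally isotropic subgroup of
order `p^k` (= a Lagrangian of the hyperbolic plane over `ℤ/p^k`) is coordinate.
(o5-r2 GEN 15 vocabulary, verbatim.) -/
def CoordinateLagrangian (p k : ℕ) : Prop :=
  ∀ A : AddSubgroup (ZMod (p ^ k) × ZMod (p ^ k)),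
    IsIsotropicSubgroup (p ^ k) A → Nat.card A = p ^ k → ∃ δ, δ ≤ k ∧ IsCoordinate p k δ A

/-- SUPPORT STATEMENT S1 (ask A-O5-G15-2): the coordinate-Lagrangian lemma holds for every odd prime `p`
and every level `k ≥ 1`. (False for `p = 2`, `k = 2`.) (o5-r2 GEN 15 vocabulary, verbatim; PROVED
below as `coordinateLagrangianOdd_holds`.) -/
def CoordinateLagrangianOdd : Prop :=
  ∀ p k : ℕ, p.Prime → p ≠ 2 → 1 ≤ k → CoordinateLagrangian p k

/-- Sanity instance of the vocabulary: the first coordinate line `R × 0` (δ = 0) is isotropic.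
[folklore] -/
theorem isIsotropic_fst_line (n : ℕ) :
    IsIsotropicSubgroup n ((⊤ : AddSubgroup (ZMod n)).prod (⊥ : AddSubgroup (ZMod n))) := by
  intro a ha b hb
  simp only [AddSubgroup.mem_prod, AddSubgroup.mem_top, AddSubgroup.mem_bot, true_and] at ha hb
  simp [hypPairing, ha, hb]

namespace CoordinateLagrangian

variable {p k : ℕ}

/-- In `ZMod n`, membership in the cyclic subgroup generated by `d` is divisibility by `d`
(every element of `ZMod n` is an integer). [folklore] -/
theorem mem_zmultiples_iff_dvd {n : ℕ} (d z : ZMod n) :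
    z ∈ AddSubgroup.zmultiples d ↔ d ∣ z := by
  rw [AddSubgroup.mem_zmultiples_iff]
  constructor
  · rintro ⟨m, rfl⟩
    exact ⟨(m : ZMod n), by rw [zsmul_eq_mul, mul_comm]⟩
  · rintro ⟨w, rfl⟩
    obtain ⟨m, rfl⟩ := ZMod.intCast_surjective w
    exact ⟨m, by rw [zsmul_eq_mul, mul_comm]⟩

/-- In `ZMod (p^k)`: if `p^j · z = 0` with `j ≤ k` then `p^(k-j) ∣ z`. [folklore] -/
theorem pow_sub_dvd_of_pow_mul_eq_zero (hp : p.Prime) {j : ℕ} (hj : j ≤ k) {z : ZMod (p ^ k)}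
    (hz : ((p ^ j : ℕ) : ZMod (p ^ k)) * z = 0) :
    ((p ^ (k - j) : ℕ) : ZMod (p ^ k)) ∣ z := by
  haveI : NeZero (p ^ k) := ⟨pow_ne_zero _ hp.ne_zero⟩
  rw [← ZMod.natCast_zmod_val z, ← Nat.cast_mul, ZMod.natCast_eq_zero_iff] at hz
  obtain ⟨m, hm⟩ := hz
  rw [← ZMod.natCast_zmod_val z]
  apply Nat.cast_dvd_cast
  refine ⟨m, Nat.eq_of_mul_eq_mul_left (pow_pos hp.pos j) ?_⟩
  rw [hm, ← mul_assoc, ← pow_add, Nat.add_sub_cancel' hj]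

/-- In `ZMod (p^k)`, an element not divisible by the prime `p` is a unit. [folklore] -/
theorem isUnit_of_not_dvd (hp : p.Prime) {c : ZMod (p ^ k)} (hc : ¬ (p : ZMod (p ^ k)) ∣ c) :
    IsUnit c := by
  haveI : NeZero (p ^ k) := ⟨pow_ne_zero _ hp.ne_zero⟩
  rw [← ZMod.natCast_zmod_val c, ZMod.isUnit_iff_coprime]
  refine Nat.Coprime.pow_right _ ?_
  rw [Nat.coprime_comm, hp.coprime_iff_not_dvd]
  intro h
  apply hc
  have h' : (p : ZMod (p ^ k)) ∣ ((c.val : ℕ) : ZMod (p ^ k)) := Nat.cast_dvd_cast h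
  rwa [ZMod.natCast_zmod_val] at h'

/-- `2` is a unit in `ZMod (p^k)` for an odd prime `p`. [folklore] -/
theorem isUnit_two (hp : p.Prime) (hp2 : p ≠ 2) : IsUnit (2 : ZMod (p ^ k)) := by
  have h : Nat.Coprime 2 (p ^ k) :=
    Nat.Coprime.pow_right _ (Nat.coprime_two_left.2 (hp.odd_of_ne_two hp2))
  have h2 := (ZMod.isUnit_iff_coprime 2 (p ^ k)).2 h
  simpa using h2

/-- The coordinate subgroup `C_δ = p^δ R × p^(k-δ) R` of `R × R`, `R = ZMod (p^k)`. -/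
def coordSubgroup (p k δ : ℕ) : AddSubgroup (ZMod (p ^ k) × ZMod (p ^ k)) :=
  (AddSubgroup.zmultiples ((p ^ δ : ℕ) : ZMod (p ^ k))).prod
    (AddSubgroup.zmultiples ((p ^ (k - δ) : ℕ) : ZMod (p ^ k)))

/-- Membership in `C_δ` is the divisibility description of `IsCoordinate`. [folklore] -/
theorem mem_coordSubgroup_iff (p k δ : ℕ) (x : ZMod (p ^ k) × ZMod (p ^ k)) :
    x ∈ coordSubgroup p k δ ↔
      ((p ^ δ : ℕ) : ZMod (p ^ k)) ∣ x.1 ∧ ((p ^ (k - δ) : ℕ) : ZMod (p ^ k)) ∣ x.2 := by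
  simp only [coordSubgroup, AddSubgroup.mem_prod, mem_zmultiples_iff_dvd]

/-- `IsCoordinate p k δ A` says exactly `A = C_δ`. [folklore] -/
theorem isCoordinate_iff_eq (p k δ : ℕ) (A : AddSubgroup (ZMod (p ^ k) × ZMod (p ^ k))) :
    IsCoordinate p k δ A ↔ A = coordSubgroup p k δ := by
  constructor
  · intro h
    ext x
    rw [h x, mem_coordSubgroup_iff]
  · rintro rfl x
    rw [mem_coordSubgroup_iff]

/-- `#(p^j · ZMod (p^k)) = p^(k-j)` for `j ≤ k`. [folklore] -/
theorem card_zmultiples_pow (hp : p.Prime) {j : ℕ} (hj : j ≤ k) :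
    Nat.card (AddSubgroup.zmultiples ((p ^ j : ℕ) : ZMod (p ^ k))) = p ^ (k - j) := by
  rw [Nat.card_zmultiples, ZMod.addOrderOf_coe _ (pow_ne_zero _ hp.ne_zero),
    Nat.gcd_eq_right (pow_dvd_pow p hj), Nat.pow_div hj hp.pos]

/-- `#C_δ = p^k` for `δ ≤ k`. [folklore] -/
theorem card_coordSubgroup (hp : p.Prime) {δ : ℕ} (hδ : δ ≤ k) :
    Nat.card (coordSubgroup p k δ) = p ^ k := by
  rw [coordSubgroup, Nat.card_congr (AddSubgroup.prodEquiv _ _).toEquiv, Nat.card_prod,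
    card_zmultiples_pow hp hδ, card_zmultiples_pow hp (Nat.sub_le k δ), Nat.sub_sub_self hδ,
    ← pow_add, Nat.sub_add_cancel hδ]

/-- Every coordinate subgroup `C_δ` is totally isotropic (the converse direction of S1: the `C_δ`,
`δ ≤ k`, are exactly the Lagrangians). [folklore] -/
theorem isIsotropic_coordSubgroup (p k δ : ℕ) (hδ : δ ≤ k) :
    IsIsotropicSubgroup (p ^ k) (coordSubgroup p k δ) := by
  intro a ha b hb
  rw [mem_coordSubgroup_iff] at ha hb
  obtain ⟨⟨a₁, ha₁⟩, ⟨a₂, ha₂⟩⟩ := ha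
  obtain ⟨⟨b₁, hb₁⟩, ⟨b₂, hb₂⟩⟩ := hb
  have hpk : ((p ^ δ : ℕ) : ZMod (p ^ k)) * ((p ^ (k - δ) : ℕ) : ZMod (p ^ k)) = 0 := by
    rw [← Nat.cast_mul, ← pow_add, Nat.add_sub_cancel' hδ, ZMod.natCast_self]
  simp only [hypPairing, ha₁, ha₂, hb₁, hb₂]
  linear_combination (a₁ * b₂ + b₁ * a₂) * hpk

/-- KEY STEP. For an odd prime `p`, `k ≥ 1` and a totally isotropic `A ≤ R × R`, `R = ZMod (p^k)`:
`A ≤ C_δ` for some `δ ≤ k` (no cardinality hypothesis needed). [folklore] -/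
theorem exists_le_coordSubgroup (hp : p.Prime) (hp2 : p ≠ 2) (hk : 1 ≤ k)
    (A : AddSubgroup (ZMod (p ^ k) × ZMod (p ^ k))) (hA : IsIsotropicSubgroup (p ^ k) A) :
    ∃ δ, δ ≤ k ∧ A ≤ coordSubgroup p k δ := by
  classical
  by_cases h0 : ∀ x ∈ A, x.1 = 0
  · -- every first coordinate vanishes: `A ≤ 0 × R = C_k`
    refine ⟨k, le_rfl, fun x hx => ?_⟩
    rw [mem_coordSubgroup_iff]
    refine ⟨?_, ?_⟩
    · rw [h0 x hx]
      exact dvd_zero _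
    · rw [Nat.sub_self, pow_zero, Nat.cast_one]
      exact one_dvd _
  · push Not at h0
    obtain ⟨x₁, hx₁A, hx₁⟩ := h0
    -- `δ` := the least `j` such that NOT every first coordinate is divisible by `p^(j+1)`
    have hQk : ¬ ∀ x ∈ A, ((p ^ (k - 1 + 1) : ℕ) : ZMod (p ^ k)) ∣ x.1 := by
      intro h
      apply hx₁
      have h1 := h x₁ hx₁A
      rw [Nat.sub_add_cancel hk, ZMod.natCast_self] at h1
      exact zero_dvd_iff.mp h1
    have hQ : ∃ j, ¬ ∀ x ∈ A, ((p ^ (j + 1) : ℕ) : ZMod (p ^ k)) ∣ x.1 := ⟨k - 1, hQk⟩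
    obtain ⟨δ, hδk, hnot, hmin⟩ : ∃ δ, δ ≤ k - 1 ∧
        (¬ ∀ x ∈ A, ((p ^ (δ + 1) : ℕ) : ZMod (p ^ k)) ∣ x.1) ∧
        ∀ j < δ, ∀ x ∈ A, ((p ^ (j + 1) : ℕ) : ZMod (p ^ k)) ∣ x.1 :=
      ⟨Nat.find hQ, Nat.find_min' hQ hQk, Nat.find_spec hQ,
        fun j hj => not_not.mp (Nat.find_min hQ hj)⟩
    -- every first coordinate is divisible by `p^δ`
    have hPδ : ∀ x ∈ A, ((p ^ δ : ℕ) : ZMod (p ^ k)) ∣ x.1 := by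
      intro x hx
      rcases Nat.eq_zero_or_pos δ with rfl | hδpos
      · rw [pow_zero, Nat.cast_one]
        exact one_dvd _
      · have h := hmin (δ - 1) (by omega) x hx
        rwa [Nat.sub_add_cancel hδpos] at h
    -- the witness `x₀` with `x₀.1 = p^δ c`, `c` a unit
    obtain ⟨x₀, hx₀A, hx₀⟩ : ∃ x₀ ∈ A, ¬ ((p ^ (δ + 1) : ℕ) : ZMod (p ^ k)) ∣ x₀.1 := by
      by_contra h
      push Not at h
      exact hnot h
    obtain ⟨c, hc⟩ := hPδ x₀ hx₀A
    have hcu : IsUnit c := by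
      refine isUnit_of_not_dvd hp (fun ⟨c', hc'⟩ => hx₀ ⟨c', ?_⟩)
      rw [hc, hc', pow_succ, Nat.cast_mul, mul_assoc]
    have h2 : IsUnit (2 : ZMod (p ^ k)) := isUnit_two hp hp2
    -- isotropy of `x₀` with itself: `p^δ x₀.2 = 0`
    have hx₀x₀ := hA x₀ hx₀A x₀ hx₀A
    simp only [hypPairing] at hx₀x₀
    rw [hc] at hx₀x₀
    have hpx₀ : ((p ^ δ : ℕ) : ZMod (p ^ k)) * x₀.2 = 0 := by
      have h' : (2 : ZMod (p ^ k)) * (c * (((p ^ δ : ℕ) : ZMod (p ^ k)) * x₀.2)) = 0 := by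
        linear_combination hx₀x₀
      exact hcu.mul_right_eq_zero.mp (h2.mul_right_eq_zero.mp h')
    refine ⟨δ, by omega, fun y hy => ?_⟩
    rw [mem_coordSubgroup_iff]
    refine ⟨hPδ y hy, pow_sub_dvd_of_pow_mul_eq_zero hp (by omega) ?_⟩
    -- isotropy of `x₀` with `y`: `p^δ y.2 = 0`
    obtain ⟨w, hw⟩ := hPδ y hy
    have hxy := hA x₀ hx₀A y hy
    simp only [hypPairing] at hxy
    rw [hc, hw] at hxy
    have h' : c * (((p ^ δ : ℕ) : ZMod (p ^ k)) * y.2) = 0 := by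
      linear_combination hxy - w * hpx₀
    exact hcu.mul_right_eq_zero.mp h'

end CoordinateLagrangian

open CoordinateLagrangian

/-- **S1 (coordinate-Lagrangian lemma, ask A-O5-G15-2).** For an odd prime `p` and `k ≥ 1`, every
totally isotropic subgroup `A ≤ ZMod (p^k) × ZMod (p^k)` (hyperbolic pairing `x y' + x' y`) of order
`p^k` is the coordinate subgroup `p^δ R × p^(k-δ) R` for some `δ ≤ k`. [folklore; o5-r2 GEN 15
`R1SHARP-DERIVATION.md` §2] -/
theorem coordinateLagrangian_of_odd {p k : ℕ} (hp : p.Prime) (hp2 : p ≠ 2) (hk : 1 ≤ k) :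
    CoordinateLagrangian p k := by
  intro A hA hcard
  haveI : NeZero (p ^ k) := ⟨pow_ne_zero _ hp.ne_zero⟩
  obtain ⟨δ, hδk, hle⟩ := exists_le_coordSubgroup hp hp2 hk A hA
  have heq : A = coordSubgroup p k δ :=
    AddSubgroup.eq_of_le_of_card_ge hle (by rw [card_coordSubgroup hp hδk, hcard])
  exact ⟨δ, hδk, (isCoordinate_iff_eq p k δ A).2 heq⟩

/-- **S1 as asked** (`CoordinateLagrangianOdd`, o5-r2 GEN 15 `gen15/lean/CoordinateLagrangianLemma.lean`):
the coordinate-Lagrangian lemma holds for every odd prime `p` and every `k ≥ 1`. [folklore] -/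
theorem coordinateLagrangianOdd_holds : CoordinateLagrangianOdd :=
  fun _ _ hp hp2 hk => coordinateLagrangian_of_odd hp hp2 hk

/-- **S1 packaged as a characterisation.** For an odd prime `p` and `k ≥ 1`, a subgroup
`A ≤ R × R`, `R = ZMod (p^k)`, is a Lagrangian of the hyperbolic plane (totally isotropic of order
`p^k`) iff it is one of the `k + 1` coordinate subgroups `C_δ = p^δ R × p^(k-δ) R`, `δ ≤ k`. [folklore] -/
theorem isIsotropic_and_card_eq_iff_exists_eq_coordSubgroup {p k : ℕ} (hp : p.Prime) (hp2 : p ≠ 2)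
    (hk : 1 ≤ k) (A : AddSubgroup (ZMod (p ^ k) × ZMod (p ^ k))) :
    (IsIsotropicSubgroup (p ^ k) A ∧ Nat.card A = p ^ k) ↔ ∃ δ, δ ≤ k ∧ A = coordSubgroup p k δ := by
  constructor
  · rintro ⟨hA, hcard⟩
    obtain ⟨δ, hδ, h⟩ := coordinateLagrangian_of_odd hp hp2 hk A hA hcard
    exact ⟨δ, hδ, (isCoordinate_iff_eq p k δ A).1 h⟩
  · rintro ⟨δ, hδ, rfl⟩
    exact ⟨isIsotropic_coordSubgroup p k δ hδ, card_coordSubgroup hp hδ⟩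

/-- UNIQUENESS of the exponent: if `A` is coordinate with exponents `δ ≤ k` and `δ' ≤ k` then `δ = δ'`
(for a prime `p`). [folklore] -/
theorem IsCoordinate.unique {p k δ δ' : ℕ} (hp : p.Prime)
    {A : AddSubgroup (ZMod (p ^ k) × ZMod (p ^ k))} (hδ : δ ≤ k) (hδ' : δ' ≤ k)
    (h : IsCoordinate p k δ A) (h' : IsCoordinate p k δ' A) : δ = δ' := by
  haveI : NeZero (p ^ k) := ⟨pow_ne_zero _ hp.ne_zero⟩
  rw [isCoordinate_iff_eq] at h h'
  have hcard : ∀ {j : ℕ}, j ≤ k →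
      Nat.card (AddSubgroup.zmultiples ((p ^ j : ℕ) : ZMod (p ^ k))) = p ^ (k - j) :=
    fun hj => card_zmultiples_pow hp hj
  -- compare the first factors `p^δ R = p^δ' R` through their cardinalities `p^(k-δ) = p^(k-δ')`
  have hfst : AddSubgroup.zmultiples ((p ^ δ : ℕ) : ZMod (p ^ k)) =
      AddSubgroup.zmultiples ((p ^ δ' : ℕ) : ZMod (p ^ k)) := by
    ext z
    have hz := SetLike.ext_iff.mp (h.symm.trans h') (z, 0)
    simpa [coordSubgroup, AddSubgroup.mem_prod, AddSubgroup.zero_mem] using hz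
  have := congrArg (fun H : AddSubgroup (ZMod (p ^ k)) => Nat.card H) hfst
  simp only [hcard hδ, hcard hδ'] at this
  have hinj := Nat.pow_right_injective hp.two_le this
  omega

/-- THE ODDNESS HYPOTHESIS IS LOAD-BEARING: for `p = 2`, `k = 2` the subgroup `⟨(1,2)⟩ ⊂ (ℤ/4)²`
(`= {(0,0),(1,2),(2,0),(3,2)}`) is totally isotropic of order `4 = 2^2` but not coordinate, so
`CoordinateLagrangian 2 2` fails. [folklore; o5-r2 GEN 15 `R1SHARP-DERIVATION.md` §2] -/
theorem not_coordinateLagrangian_two_two : ¬ CoordinateLagrangian 2 2 := by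
  intro h
  -- the graph of multiplication by `2`: `{(x, 2x)} = ⟨(1,2)⟩ ⊂ (ℤ/4)²`
  let A : AddSubgroup (ZMod (2 ^ 2) × ZMod (2 ^ 2)) :=
    { carrier := {x | x.2 = 2 * x.1}
      zero_mem' := by simp
      add_mem' := by
        rintro a b (ha : a.2 = 2 * a.1) (hb : b.2 = 2 * b.1)
        show (a + b).2 = 2 * (a + b).1
        rw [Prod.snd_add, Prod.fst_add, ha, hb, mul_add]
      neg_mem' := by
        rintro a (ha : a.2 = 2 * a.1)
        show (-a).2 = 2 * (-a).1
        rw [Prod.snd_neg, Prod.fst_neg, ha, mul_neg] }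
  have hmem : ∀ x : ZMod (2 ^ 2) × ZMod (2 ^ 2), x ∈ A ↔ x.2 = 2 * x.1 := fun x => Iff.rfl
  have hiso : IsIsotropicSubgroup (2 ^ 2) A := by
    intro a ha b hb
    rw [hmem] at ha hb
    have h4 : (4 : ZMod (2 ^ 2)) = 0 := by decide
    simp only [hypPairing, ha, hb]
    linear_combination a.1 * b.1 * h4
  have hcard : Nat.card A = 2 ^ 2 := by
    have e : A ≃ ZMod (2 ^ 2) :=
      { toFun := fun x => x.1.1
        invFun := fun c => ⟨(c, 2 * c), (hmem _).2 rfl⟩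
        left_inv := fun x => Subtype.ext (Prod.ext rfl ((hmem _).1 x.2).symm)
        right_inv := fun c => rfl }
    rw [Nat.card_congr e, Nat.card_zmod]
  obtain ⟨δ, hδ, hcoord⟩ := h A hiso hcard
  have hx : ((1, 2) : ZMod (2 ^ 2) × ZMod (2 ^ 2)) ∈ A := (hmem _).2 (by decide)
  obtain ⟨⟨c₁, hc₁⟩, ⟨c₂, hc₂⟩⟩ := (hcoord (1, 2)).1 hx
  -- `δ ∈ {0, 1, 2}`; `δ = 0`: `4 ∣ 2` in `ℤ/4` is false; `δ = 1, 2`: `2 ∣ 1`, `4 ∣ 1` are false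
  interval_cases δ
  · revert c₂ hc₂
    decide
  · revert c₁ hc₁
    decide
  · revert c₁ hc₁
    decide

end Summit.BirchSwinnertonDyer.Rank1Residual.O5
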